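import Summits.Ventures.HSemireg.WedgeHankelRecurrenceHermiteFujiwara
import Summits.Ventures.HSemireg.WedgeHankelRecurrenceBezoutian

/-!
# Venture HSemireg — THE RANK OF THE HERMITE–FUJIWARA MATRIX: `H_n(p) = B_n(p(−X), p̄) · diag((−1)^j)`, hence **`rank H_n(p) = rank B_n(p(−X), p̄)`** over any field with a star, and for `p` MONIC of
# degree `n` **`rank H_n(p) + deg gcd(p̄, p(−X)) = n`** (BPR Thm 9.4 (rank) through this lineage's N141) — the nullity of the Hermite–Fujiwara form is the number of root pairs `{z, −z̄}` of `p`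
# (roots on the imaginary axis and mirror pairs), the unconditional complement of Hermite's theorem N185 («Theorem 5.52 can be generalized by omitting the coprimeness assumption», F–H p. 274)

HONEST FRAMING. Part of the Lean index of the computation cell `pub-hsemireg` (seat p10 gen 38, Sunday typer «UNIFORM-IN-n»).
LINEAR ALGEBRA OF MATRICES AND POLYNOMIALS OVER A FIELD ONLY (Mathlib `Matrix.rank`, `EuclideanDomain.gcd`; PROVED Literature `Bezoutian`; this lineage's N141 `rank_bezoutian_add_natDegree_gcd`): no variety, no
cohomology theory, no sheaf, no Ext group and no semiregularity map is constructed here; nothing here says that HC / HC_CM / HC_AV holds; no Literature fact (unproved `Prop`) is declared or used.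
Custodian versions as in `WedgeHankelSiegelIdeal` (1/3).
SOURCE (cited; held texts read: `book:fuhrmann2015-mathematics-networks-linear-systems` p0264–p0265; `book:basu2006-algorithms-real-algebraic-geometry` p. 326 Thm 9.4): P. A. Fuhrmann, U. Helmke (2015)
§5.5, after Thm 5.52: «Theorem 5.52 can be generalized by omitting the coprimeness assumption of `p(z)` and `p̄(−z)`» and proof of Thm 5.53: «`B(p̄, p_*) = H_n(p)S` … `S = diag(1, −1, ⋯, (−1)^{n−1})`»;
S. Basu, R. Pollack, M.-F. Roy (2006) **Theorem 9.4** «`Rank(Bez(P,Q)) = deg(P) − deg(gcd(P,Q))`» — in the tree as N141 `rank_bezoutian_add_natDegree_gcd` (monic second argument), here specialised to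
the pair `(p(−X), p̄)`.
DEDUP DISCLOSURE (`rg` of the whole tree + Mathlib, 2026-09-02): N141 (`…Bezoutian`) has the rank of `B(a, m)` for monic `m` (USED); N185 ∕ N186 give `det H_n(p) ≠ 0 ⟺ p ⊥ p̄(−z)` over `ℂ`; no file
states the rank of `H_n(p)`.  5 names: 0 hits tree-wide.

WHAT IS IN THE TREE.  N183: `hermiteFujiwara`, `hermiteFujiwara_apply`, `hermiteFujiwara_C_mul`; N141: **`rank_bezoutian_add_natDegree_gcd`** (`rank B_{t+1}(a, m) + deg gcd(m, a) = t + 1`, `m` monic of degree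
`t + 1`, `deg a ≤ t + 1`); N184's `natDegree_comp_neg_X_eq` is NOT imported (N184 pulls the inertia library; this leaf stays PLAIN on N183 + N141 and re-derives the one-line degree bound).
Mathlib: `Matrix.rank_mul_eq_left/right_of_isUnit_det`, `Matrix.det_diagonal`, `Matrix.smul_eq_diagonal_mul`.
THIS FILE (namespace `Summit.Ventures.HSemireg.Wedge.HankelOuter` continued; PLAIN over N183 + N141; 0 definitions):
* §864 `hermiteFujiwara_eq_bezoutian_mul_diagonal` (`H_n(p) = B_n(p(−X), p̄) · diag((−1)^j)`, any commutative star ring), `isUnit_det_diagonal_neg_one_pow`, **`rank_hermiteFujiwara_eq_rank_bezoutian`**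
  (any field with star), `monic_map_starRingEnd` (bookkeeping), **`rank_hermiteFujiwara_add_natDegree_gcd`** (`p` monic of degree `t + 1`: `rank H_{t+1}(p) + deg gcd(p̄, p(−X)) = t + 1`),
  `rank_hermiteFujiwara_C_mul` (`rank H_n(a·p) = rank H_n(p)` for `a ā ≠ 0`).
CAVEATS.  The inertia of `H_n(p)` in the non-coprime case (`i_± = n_∓(p / gcd)`, via `H(d) = 0` for the symmetric factor `d` and Dym's Thm 28.7) is NOT typed here; `gcd` is Mathlib's `EuclideanDomain.gcd`
of `K[X]` (defined up to the normalisation Mathlib chooses; only its degree enters).  Nothing Ext-side.  New names only.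
-/

open Module Polynomial
open scoped Matrix Polynomial

namespace Summit.Ventures.HSemireg.Wedge.HankelOuter

open Summit.Ventures.HSemireg.Wedge Summit.Ventures.HSemireg.Wedge.Hankel
open Literature.LinearAlgebra.Matrix.Bezoutian (bezCoeff bezoutian bezoutian_apply)

/-! ## §864. `H_n(p) = B_n(p(−X), p̄) · diag((−1)^j)` and the rank -/

section AnyRing

variable {R : Type*} [CommRing R] [StarRing R]

/-- **`H_n(p) = B_n(p(−X), p̄) · S`, `S = diag(1, −1, …, (−1)^{n−1})`** (F–H: «`B(p̄, p_*) = H_n(p)S`» up to their argument order). [this file, §864] -/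
theorem hermiteFujiwara_eq_bezoutian_mul_diagonal (n : ℕ) (p : R[X]) :
    hermiteFujiwara n p = bezoutian n (p.comp (-Polynomial.X)) (p.map (starRingEnd R)) * Matrix.diagonal (fun j : Fin n => (-1 : R) ^ (j : ℕ)) := by
  ext i j
  rw [Matrix.mul_diagonal, hermiteFujiwara_apply, bezoutian_apply, mul_comm]

omit [StarRing R] in
/-- `S = diag((−1)^j)` is invertible (`S² = 1`). [bookkeeping] -/
theorem isUnit_det_diagonal_neg_one_pow (n : ℕ) : IsUnit (Matrix.diagonal (fun j : Fin n => (-1 : R) ^ (j : ℕ))).det := by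
  rw [Matrix.det_diagonal]
  exact isUnit_iff_exists_inv.2 ⟨∏ j : Fin n, (-1 : R) ^ (j : ℕ), by
    rw [← Finset.prod_mul_distrib, Finset.prod_eq_one fun j _ => by rw [← pow_add, ← two_mul, pow_mul, neg_one_sq, one_pow]]⟩

end AnyRing

section Field

variable (K : Type*) [Field K] [StarRing K]

/-- **`rank H_n(p) = rank B_n(p(−X), p̄)`** (any field with a star). [this file, §864] -/
theorem rank_hermiteFujiwara_eq_rank_bezoutian (n : ℕ) (p : K[X]) : (hermiteFujiwara n p).rank = (bezoutian n (p.comp (-Polynomial.X)) (p.map (starRingEnd K))).rank := by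
  rw [hermiteFujiwara_eq_bezoutian_mul_diagonal, Matrix.rank_mul_eq_left_of_isUnit_det _ _ (isUnit_det_diagonal_neg_one_pow n)]

/-- `p̄` is monic when `p` is. [bookkeeping] -/
theorem monic_map_starRingEnd {p : K[X]} (hp : p.Monic) : (p.map (starRingEnd K)).Monic := hp.map _

/-- **`rank H_{t+1}(p) + deg gcd(p̄, p(−X)) = t + 1` for `p` monic of degree `t + 1`** (BPR Thm 9.4 rank formula for the pair `(p(−X), p̄)`, N141): the NULLITY of the Hermite–Fujiwara form is the
degree of the greatest common divisor of `p̄` and `p(−X)`, i.e. (over `ℂ`) the number of roots `z` of `p`, with multiplicity, whose mirror image `−z̄` is also a root. [this file, §864] -/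
theorem rank_hermiteFujiwara_add_natDegree_gcd [DecidableEq K] {t : ℕ} {p : K[X]} (hp : p.Monic) (hpd : p.natDegree = t + 1) :
    (hermiteFujiwara (t + 1) p).rank + (EuclideanDomain.gcd (p.map (starRingEnd K)) (p.comp (-Polynomial.X))).natDegree = t + 1 := by
  rw [rank_hermiteFujiwara_eq_rank_bezoutian]
  exact rank_bezoutian_add_natDegree_gcd K (monic_map_starRingEnd K hp) (by rw [Polynomial.natDegree_map_eq_of_injective (RingHom.injective _), hpd])
    ((Polynomial.natDegree_le_natDegree (Polynomial.degree_comp_neg_X (p := p)).le).trans hpd.le)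

/-- **Scaling does not change the rank: `rank H_n(a·p) = rank H_n(p)` for `a·ā ≠ 0`** (`H_n(a p) = a ā · H_n(p)`, N183). [this file, §864] -/
theorem rank_hermiteFujiwara_C_mul (n : ℕ) {a : K} (ha : a * star a ≠ 0) (p : K[X]) : (hermiteFujiwara n (Polynomial.C a * p)).rank = (hermiteFujiwara n p).rank := by
  rw [hermiteFujiwara_C_mul, Matrix.smul_eq_diagonal_mul]
  exact Matrix.rank_mul_eq_right_of_isUnit_det _ _ (by rw [Matrix.det_diagonal, Finset.prod_const]; exact (isUnit_iff_ne_zero.2 ha).pow _)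

end Field

end Summit.Ventures.HSemireg.Wedge.HankelOuter
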